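import Mathlib.NumberTheory.Real.Irrational
import Mathlib.Analysis.SpecialFunctions.Exp
import Mathlib.Analysis.SpecialFunctions.Log.Basic
import Literature.NumberTheory.Transcendental.ZetaLinearFormsCriterion
import Literature.NumberTheory.Transcendental.PeriodsWave0
import HarnessLib

/-!
# ζ(5) search — the recurrence-first certificate `ApproximationCertificate` (cell `pub-zeta5`, TYPER)

HONEST FRAMING: systematic search; no irrationality claim unless certified.

Companion of `Criteria.lean`. The search engines of the cell work RECURRENCE-FIRST (Apéry /
Zeilberger–Zudilin style): a candidate is a pair of rational sequences `u n, v n` — two solutions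
of one linear recurrence with polynomial coefficients, fixed by their initial values — such that
`v n / u n → ξ`. This file types the exact finitary data such a pair must come with in order to
prove `ξ ∉ ℚ`, and PROVES the implication (`ApproximationCertificate.irrational`):

* growth: `e^{Q n} ≤ u n ≤ e^{Q' n}` for large `n` (from the recurrence by a ratio induction, or
  from Poincaré–Perron with a certified root separation);
* the CASORATIAN `W n = u n · v (n+1) - u (n+1) · v n`: `|W n| ≤ K e^{w n}` for large `n` and
  `W n ≠ 0` infinitely often (for a second-order recurrence `W` has a closed form — Abel's lemma —
  so both are identities; this is what replaces an analytic saddle-point bound);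
* the limit `v n / u n → ξ` (the identification of `ξ`, from the integral / hypergeometric origin
  of the family);
* arithmetic: `D n · u n ∈ ℤ`, `D n · v n ∈ ℤ` for large `n`, with `D n ≤ e^{δ n}` (`lcm`-type
  denominators; the rate `δ` is supplied by the prime number theorem proved in the tree, see
  `Criteria.lean`, `eventually_prod_lcmUpto_pow_le_exp`);
* the MARGIN inequality `δ + Q' + w < 2 Q`.

Why this suffices (proof below, all finitary): `v (i+1)/u (i+1) - v i/u i = W i /(u i · u (i+1))`
has absolute value `≤ K e^{-Q} e^{(w - 2Q) i}`; the margin forces `w - 2Q < 0`, so telescoping and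
passing to the limit gives `|ξ - v n/u n| ≤ C e^{(w-2Q) n}`, hence
`|D n (u n ξ - v n)| ≤ C e^{(δ + Q' + w - 2Q) n} → 0`; and `W n ≠ 0` forces one of the two
consecutive forms `u n ξ - v n`, `u (n+1) ξ - v (n+1)` to be non-zero. The elementary criterion
(tree: `Literature.NumberTheory.Transcendental.exists_irrational_of_integerLinearForms`) concludes.
In the cell's units (`CRITERIA.md`): decay of the integer-normalised forms `c = Q - w` (when
`Q' = Q`), margin `μ₁ = 2Q - Q' - w - δ`.

Calibration (Apéry, `ξ = ζ(3)`): `u = b_n ∈ ℤ`, `v = a_n`, `D n = lcm(1..n)³` (`δ = 3`),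
`Q = Q' = 4 log(1+√2) = 3.5255…` up to `ε`, `W n = 6/(n+1)³` (`w = 0`): margin `0.5255 > 0`.

Everything is PROVED; no named fact, no `sorry`, no closed `Prop` definition. Instantiations:
`zetaFiveIrrational_of_approximationCertificate`, `catalanIrrational_of_approximationCertificate`
(implications only — no certificate for `ζ(5)` or `G` is constructed anywhere).
-/

noncomputable section

open Filter Topology Finset
open Literature.NumberTheory.Transcendental

namespace Summit.KontsevichZagierPeriods.Zeta5Search

/-- **Recurrence-first irrationality certificate for `ξ`** (cell `CRITERIA.md`, certificate
format A): rational sequences `u, v` with `v n / u n → ξ`, growth `e^{Q n} ≤ u n ≤ e^{Q' n}` (`Q > 0`),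
Casoratian bound `|u n v (n+1) - u (n+1) v n| ≤ K e^{w n}` and non-vanishing infinitely often,
denominators `D n` (`D n u n, D n v n ∈ ℤ`, `D n ≤ e^{δ n}`), all for large `n`, and the margin
`δ + Q' + w < 2Q`. Then `ξ` is irrational (`ApproximationCertificate.irrational`). -/
structure ApproximationCertificate (ξ : ℝ) where
  /-- the coefficients `u n` of `ξ` (Apéry's `b_n`) -/
  u : ℕ → ℚ
  /-- the approximating numerators `v n` (Apéry's `a_n`), `v n / u n → ξ` -/
  v : ℕ → ℚ
  /-- the common denominators `D n` of `u n, v n` -/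
  denom : ℕ → ℕ
  /-- lower growth exponent `Q`: `e^{Q n} ≤ u n` -/
  growthLow : ℝ
  /-- upper growth exponent `Q'`: `u n ≤ e^{Q' n}` -/
  growthUp : ℝ
  /-- Casoratian constant `K` -/
  casoratiConst : ℝ
  /-- Casoratian exponent `w`: `|u n v (n+1) - u (n+1) v n| ≤ K e^{w n}` -/
  casoratiRate : ℝ
  /-- denominator exponent `δ`: `D n ≤ e^{δ n}` -/
  denomRate : ℝ
  /-- `Q > 0`: the coefficients grow -/
  growthLow_pos : 0 < growthLow
  /-- `D n > 0` -/
  denom_pos : ∀ n, 0 < denom n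
  /-- `D n · u n ∈ ℤ` for large `n` -/
  isInt_u : ∀ᶠ n : ℕ in atTop, ∃ z : ℤ, (denom n : ℚ) * u n = z
  /-- `D n · v n ∈ ℤ` for large `n` -/
  isInt_v : ∀ᶠ n : ℕ in atTop, ∃ z : ℤ, (denom n : ℚ) * v n = z
  /-- `e^{Q n} ≤ u n` for large `n` -/
  growth_lower : ∀ᶠ n : ℕ in atTop, Real.exp (growthLow * n) ≤ (u n : ℝ)
  /-- `u n ≤ e^{Q' n}` for large `n` -/
  growth_upper : ∀ᶠ n : ℕ in atTop, (u n : ℝ) ≤ Real.exp (growthUp * n)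
  /-- `|u n v (n+1) - u (n+1) v n| ≤ K e^{w n}` for large `n` -/
  casorati_le : ∀ᶠ n : ℕ in atTop,
    |((u n * v (n + 1) - u (n + 1) * v n : ℚ) : ℝ)| ≤ casoratiConst * Real.exp (casoratiRate * n)
  /-- `u n v (n+1) - u (n+1) v n ≠ 0` for infinitely many `n` -/
  casorati_ne : ∃ᶠ n : ℕ in atTop, u n * v (n + 1) - u (n + 1) * v n ≠ 0
  /-- `v n / u n → ξ` -/
  tendsto_div : Tendsto (fun n : ℕ => (v n : ℝ) / (u n : ℝ)) atTop (𝓝 ξ)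
  /-- `D n ≤ e^{δ n}` for large `n` -/
  denom_le : ∀ᶠ n : ℕ in atTop, (denom n : ℝ) ≤ Real.exp (denomRate * n)
  /-- the margin inequality `δ + Q' + w < 2Q` -/
  margin : denomRate + growthUp + casoratiRate < 2 * growthLow

namespace ApproximationCertificate

variable {ξ : ℝ}

/-- The margin `2Q - Q' - w - δ > 0` of an approximation certificate. -/
def marginValue (cert : ApproximationCertificate ξ) : ℝ :=
  2 * cert.growthLow - cert.growthUp - cert.casoratiRate - cert.denomRate

/-- The margin of an approximation certificate is positive. -/
theorem marginValue_pos (cert : ApproximationCertificate ξ) : 0 < cert.marginValue := by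
  have := cert.margin; unfold marginValue; linarith

/-- The denominator exponent of a certificate is non-negative (`1 ≤ D n ≤ e^{δ n}`). -/
theorem denomRate_nonneg (cert : ApproximationCertificate ξ) : 0 ≤ cert.denomRate := by
  obtain ⟨n, hn1, hn⟩ := ((eventually_ge_atTop 1).and cert.denom_le).exists
  have hD : (1 : ℝ) ≤ cert.denom n := by exact_mod_cast cert.denom_pos n
  have h := Real.log_le_log one_pos (hD.trans hn)
  rw [Real.log_one, Real.log_exp] at h
  have hn' : (1 : ℝ) ≤ n := by exact_mod_cast hn1
  nlinarith

/-- The growth exponents of a certificate satisfy `Q ≤ Q'`. -/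
theorem growthLow_le_growthUp (cert : ApproximationCertificate ξ) :
    cert.growthLow ≤ cert.growthUp := by
  obtain ⟨n, hn1, hlo, hup⟩ :=
    ((eventually_ge_atTop 1).and (cert.growth_lower.and cert.growth_upper)).exists
  have h := Real.exp_le_exp.1 (hlo.trans hup)
  have hn' : (1 : ℝ) ≤ n := by exact_mod_cast hn1
  nlinarith

/-- The telescoping rate `r = w - 2Q` of a certificate is negative. -/
theorem rate_neg (cert : ApproximationCertificate ξ) :
    cert.casoratiRate - 2 * cert.growthLow < 0 := by
  have h1 := cert.margin
  have h2 := cert.denomRate_nonneg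
  have h3 := cert.growthLow_le_growthUp
  have h4 := cert.growthLow_pos
  linarith

/-- The Casoratian constant of a certificate is non-negative. -/
theorem casoratiConst_nonneg (cert : ApproximationCertificate ξ) : 0 ≤ cert.casoratiConst := by
  obtain ⟨n, hn⟩ := cert.casorati_le.exists
  have h0 : (0 : ℝ) ≤ cert.casoratiConst * Real.exp (cert.casoratiRate * n) :=
    (abs_nonneg _).trans hn
  exact nonneg_of_mul_nonneg_left h0 (Real.exp_pos _)

/-- **One telescoping step.** For large `i`:
`|v (i+1)/u (i+1) - v i/u i| ≤ K e^{-Q} e^{(w-2Q) i}`. -/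
theorem eventually_abs_step_le (cert : ApproximationCertificate ξ) :
    ∀ᶠ i : ℕ in atTop, |(cert.v (i + 1) : ℝ) / cert.u (i + 1) - (cert.v i : ℝ) / cert.u i| ≤
      cert.casoratiConst * Real.exp (-cert.growthLow) *
        Real.exp ((cert.casoratiRate - 2 * cert.growthLow) * i) := by
  have hshift : Tendsto (fun i : ℕ => i + 1) atTop atTop := tendsto_add_atTop_nat 1
  filter_upwards [cert.growth_lower, hshift.eventually cert.growth_lower, cert.casorati_le]
    with i hlo hlo1 hW
  have hu0 : (0 : ℝ) < cert.u i := (Real.exp_pos _).trans_le hlo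
  have hu1 : (0 : ℝ) < cert.u (i + 1) := (Real.exp_pos _).trans_le hlo1
  have hid : (cert.v (i + 1) : ℝ) / cert.u (i + 1) - (cert.v i : ℝ) / cert.u i =
      ((cert.u i * cert.v (i + 1) - cert.u (i + 1) * cert.v i : ℚ) : ℝ) /
        ((cert.u i : ℝ) * cert.u (i + 1)) := by
    push_cast
    field_simp
  rw [hid, abs_div, abs_of_pos (mul_pos hu0 hu1), div_le_iff₀ (mul_pos hu0 hu1)]
  have hK := cert.casoratiConst_nonneg
  calc |((cert.u i * cert.v (i + 1) - cert.u (i + 1) * cert.v i : ℚ) : ℝ)|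
      ≤ cert.casoratiConst * Real.exp (cert.casoratiRate * i) := hW
    _ = cert.casoratiConst * Real.exp (-cert.growthLow) *
          Real.exp ((cert.casoratiRate - 2 * cert.growthLow) * i) *
          (Real.exp (cert.growthLow * i) * Real.exp (cert.growthLow * ((i + 1 : ℕ) : ℝ))) := by
        rw [mul_assoc, mul_assoc, ← Real.exp_add, ← Real.exp_add, ← Real.exp_add]
        congr 2
        push_cast
        ring
    _ ≤ cert.casoratiConst * Real.exp (-cert.growthLow) *
          Real.exp ((cert.casoratiRate - 2 * cert.growthLow) * i) *
          ((cert.u i : ℝ) * cert.u (i + 1)) := by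
        refine mul_le_mul_of_nonneg_left ?_ (by positivity)
        exact mul_le_mul hlo hlo1 (Real.exp_pos _).le hu0.le

/-- **Telescoping.** There is `N` such that for `N ≤ n ≤ m`:
`|v m/u m - v n/u n| ≤ K e^{-Q} (e^{r n} - e^{r m}) / (1 - e^{r})`, `r = w - 2Q < 0`. -/
theorem exists_abs_sub_le (cert : ApproximationCertificate ξ) :
    ∃ N : ℕ, ∀ n, N ≤ n → ∀ m, n ≤ m →
      |(cert.v m : ℝ) / cert.u m - (cert.v n : ℝ) / cert.u n| ≤
        cert.casoratiConst * Real.exp (-cert.growthLow) *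
          (Real.exp ((cert.casoratiRate - 2 * cert.growthLow) * n) -
            Real.exp ((cert.casoratiRate - 2 * cert.growthLow) * m)) /
          (1 - Real.exp (cert.casoratiRate - 2 * cert.growthLow)) := by
  obtain ⟨N, hN⟩ := eventually_atTop.1 cert.eventually_abs_step_le
  set r : ℝ := cert.casoratiRate - 2 * cert.growthLow with hr
  set K₁ : ℝ := cert.casoratiConst * Real.exp (-cert.growthLow) with hK₁
  have hr0 : r < 0 := cert.rate_neg
  have h1r : 0 < 1 - Real.exp r := by
    have : Real.exp r < 1 := Real.exp_lt_one_iff.2 hr0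
    linarith
  refine ⟨N, fun n hn => ?_⟩
  refine Nat.le_induction ?_ ?_
  · simp
  · intro m hnm ih
    have hstep := hN m (hn.trans hnm)
    have hsplit : |(cert.v (m + 1) : ℝ) / cert.u (m + 1) - (cert.v n : ℝ) / cert.u n| ≤
        |(cert.v (m + 1) : ℝ) / cert.u (m + 1) - (cert.v m : ℝ) / cert.u m| +
          |(cert.v m : ℝ) / cert.u m - (cert.v n : ℝ) / cert.u n| := abs_sub_le _ _ _
    have hexp : Real.exp (r * ((m + 1 : ℕ) : ℝ)) = Real.exp (r * m) * Real.exp r := by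
      rw [← Real.exp_add]; congr 1; push_cast; ring
    calc |(cert.v (m + 1) : ℝ) / cert.u (m + 1) - (cert.v n : ℝ) / cert.u n|
        ≤ K₁ * Real.exp (r * m) + K₁ * (Real.exp (r * n) - Real.exp (r * m)) / (1 - Real.exp r) :=
          hsplit.trans (add_le_add hstep ih)
      _ = K₁ * (Real.exp (r * n) - Real.exp (r * ((m + 1 : ℕ) : ℝ))) / (1 - Real.exp r) := by
          rw [hexp]
          field_simp
          ring

/-- **Quality of the approximations.** For large `n`:
`|ξ - v n/u n| ≤ K e^{-Q} e^{(w-2Q) n} / (1 - e^{w-2Q})` (pass to the limit `m → ∞` in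
`exists_abs_sub_le`). -/
theorem eventually_abs_sub_lim_le (cert : ApproximationCertificate ξ) :
    ∀ᶠ n : ℕ in atTop, |ξ - (cert.v n : ℝ) / cert.u n| ≤
      cert.casoratiConst * Real.exp (-cert.growthLow) *
        Real.exp ((cert.casoratiRate - 2 * cert.growthLow) * n) /
        (1 - Real.exp (cert.casoratiRate - 2 * cert.growthLow)) := by
  obtain ⟨N, hN⟩ := cert.exists_abs_sub_le
  set r : ℝ := cert.casoratiRate - 2 * cert.growthLow with hr
  set K₁ : ℝ := cert.casoratiConst * Real.exp (-cert.growthLow) with hK₁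
  have hr0 : r < 0 := cert.rate_neg
  have h1r : 0 < 1 - Real.exp r := by
    have : Real.exp r < 1 := Real.exp_lt_one_iff.2 hr0
    linarith
  have hK₁ : 0 ≤ K₁ := mul_nonneg cert.casoratiConst_nonneg (Real.exp_pos _).le
  filter_upwards [eventually_ge_atTop N] with n hn
  -- the limit of `|v m/u m - v n/u n|` as `m → ∞` is `|ξ - v n/u n|`
  have hlim : Tendsto (fun m : ℕ => |(cert.v m : ℝ) / cert.u m - (cert.v n : ℝ) / cert.u n|)
      atTop (𝓝 |ξ - (cert.v n : ℝ) / cert.u n|) :=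
    (cert.tendsto_div.sub_const _).abs
  refine le_of_tendsto hlim ?_
  filter_upwards [eventually_ge_atTop n] with m hm
  refine (hN n hn m hm).trans ?_
  rw [mul_sub, sub_div]
  have : 0 ≤ K₁ * Real.exp (r * m) / (1 - Real.exp r) := by positivity
  linarith

/-- **Decay of the scaled forms.** For large `n`:
`|D n (u n ξ - v n)| ≤ C e^{(δ + Q' + w - 2Q) n}` with
`C = K e^{-Q} / (1 - e^{w - 2Q})`. -/
theorem eventually_abs_form_le (cert : ApproximationCertificate ξ) :
    ∀ᶠ n : ℕ in atTop, |(cert.denom n : ℝ) * ((cert.u n : ℝ) * ξ - cert.v n)| ≤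
      cert.casoratiConst * Real.exp (-cert.growthLow) /
          (1 - Real.exp (cert.casoratiRate - 2 * cert.growthLow)) *
        Real.exp (-(cert.marginValue * n)) := by
  set r : ℝ := cert.casoratiRate - 2 * cert.growthLow with hr
  set K₁ : ℝ := cert.casoratiConst * Real.exp (-cert.growthLow) with hK₁
  have hr0 : r < 0 := cert.rate_neg
  have h1r : 0 < 1 - Real.exp r := by
    have : Real.exp r < 1 := Real.exp_lt_one_iff.2 hr0
    linarith
  have hK₁0 : 0 ≤ K₁ := mul_nonneg cert.casoratiConst_nonneg (Real.exp_pos _).le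
  filter_upwards [cert.eventually_abs_sub_lim_le, cert.growth_lower, cert.growth_upper,
    cert.denom_le] with n happ hlo hup hD
  have hu0 : (0 : ℝ) < cert.u n := (Real.exp_pos _).trans_le hlo
  have hD0 : (0 : ℝ) ≤ cert.denom n := by positivity
  have hid : (cert.denom n : ℝ) * ((cert.u n : ℝ) * ξ - cert.v n) =
      (cert.denom n : ℝ) * cert.u n * (ξ - (cert.v n : ℝ) / cert.u n) := by
    field_simp
  rw [hid, abs_mul, abs_mul, abs_of_nonneg hD0, abs_of_pos hu0]
  calc (cert.denom n : ℝ) * cert.u n * |ξ - (cert.v n : ℝ) / cert.u n|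
      ≤ Real.exp (cert.denomRate * n) * Real.exp (cert.growthUp * n) *
          (K₁ * Real.exp (r * n) / (1 - Real.exp r)) := by
        refine mul_le_mul (mul_le_mul hD hup hu0.le (Real.exp_pos _).le) happ (abs_nonneg _)
          (by positivity)
    _ = K₁ / (1 - Real.exp r) * Real.exp (-(cert.marginValue * n)) := by
        have e : Real.exp (cert.denomRate * n) * Real.exp (cert.growthUp * n) * Real.exp (r * n) =
            Real.exp (-(cert.marginValue * n)) := by
          rw [← Real.exp_add, ← Real.exp_add]
          congr 1
          simp only [marginValue, hr]
          ring
        rw [← e]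
        field_simp

/-- The scaled forms `D n (u n ξ - v n)` of a certificate tend to `0`. -/
theorem tendsto_form (cert : ApproximationCertificate ξ) :
    Tendsto (fun n : ℕ => (cert.denom n : ℝ) * ((cert.u n : ℝ) * ξ - cert.v n)) atTop (𝓝 0) := by
  have hm := cert.marginValue_pos
  set C : ℝ := cert.casoratiConst * Real.exp (-cert.growthLow) /
      (1 - Real.exp (cert.casoratiRate - 2 * cert.growthLow)) with hC
  have h0 : Tendsto (fun n : ℕ => C * Real.exp (-(cert.marginValue * n))) atTop (𝓝 0) := by
    rw [show (0 : ℝ) = C * 0 by simp]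
    refine Tendsto.const_mul C ?_
    refine Real.tendsto_exp_atBot.comp ?_
    have h1 : Tendsto (fun n : ℕ => cert.marginValue * (n : ℝ)) atTop atTop :=
      (tendsto_natCast_atTop_atTop).const_mul_atTop hm
    show Tendsto (fun n : ℕ => -(cert.marginValue * (n : ℝ))) atTop atBot
    exact tendsto_neg_atTop_atBot.comp h1
  refine squeeze_zero_norm' ?_ h0
  filter_upwards [cert.eventually_abs_form_le] with n hn
  rw [Real.norm_eq_abs]
  exact hn

/-- The forms `u n ξ - v n` of a certificate are non-zero for infinitely many `n`
(a vanishing pair of consecutive forms would kill the Casoratian). -/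
theorem frequently_form_ne_zero (cert : ApproximationCertificate ξ) :
    ∃ᶠ n : ℕ in atTop, (cert.u n : ℝ) * ξ - cert.v n ≠ 0 := by
  by_contra hcon
  rw [not_frequently] at hcon
  simp only [not_not] at hcon
  have hshift : Tendsto (fun n : ℕ => n + 1) atTop atTop := tendsto_add_atTop_nat 1
  have hW : ∀ᶠ n : ℕ in atTop, cert.u n * cert.v (n + 1) - cert.u (n + 1) * cert.v n = 0 := by
    filter_upwards [hcon, hshift.eventually hcon] with n h0 h1
    have h0' : (cert.v n : ℝ) = cert.u n * ξ := by linarith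
    have h1' : (cert.v (n + 1) : ℝ) = cert.u (n + 1) * ξ := by linarith
    have : ((cert.u n * cert.v (n + 1) - cert.u (n + 1) * cert.v n : ℚ) : ℝ) = 0 := by
      push_cast
      rw [h0', h1']
      ring
    exact_mod_cast this
  exact cert.casorati_ne (hW.mono fun n hn h => h hn)

/-- **Certificate ⇒ irrational.** An `ApproximationCertificate ξ` proves `Irrational ξ`. -/
theorem irrational (cert : ApproximationCertificate ξ) : Irrational ξ := by
  classical
  -- integer representatives of `D n v n` and `D n u n`
  set a : ℕ → ℤ := fun n =>
    if h : ∃ z : ℤ, (cert.denom n : ℚ) * cert.v n = z then -h.choose else 0 with ha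
  set b : ℕ → ℤ := fun n =>
    if h : ∃ z : ℤ, (cert.denom n : ℚ) * cert.u n = z then h.choose else 0 with hb
  have hab : ∀ᶠ n : ℕ in atTop, (a n : ℝ) + b n * ξ =
      (cert.denom n : ℝ) * ((cert.u n : ℝ) * ξ - cert.v n) := by
    filter_upwards [cert.isInt_u, cert.isInt_v] with n hu hv
    have hb' : (b n : ℚ) = (cert.denom n : ℚ) * cert.u n := by
      simp only [hb, dif_pos hu]; exact hu.choose_spec.symm
    have ha' : (a n : ℚ) = -((cert.denom n : ℚ) * cert.v n) := by
      have h := hv.choose_spec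
      simp only [ha, dif_pos hv, Int.cast_neg]
      linarith
    have hb'' : (b n : ℝ) = (cert.denom n : ℝ) * cert.u n := by exact_mod_cast hb'
    have ha'' : (a n : ℝ) = -((cert.denom n : ℝ) * cert.v n) := by exact_mod_cast ha'
    rw [ha'', hb'']
    ring
  have hsmall : Tendsto (fun n => (a n : ℝ) + b n * ξ) atTop (𝓝 0) :=
    cert.tendsto_form.congr' (EventuallyEq.symm hab)
  have hne : ∃ᶠ n : ℕ in atTop, (a n : ℝ) + b n * ξ ≠ 0 := by
    refine (cert.frequently_form_ne_zero.and_eventually hab).mono fun n hn => ?_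
    rw [hn.2]
    have hD : (cert.denom n : ℝ) ≠ 0 := by exact_mod_cast (cert.denom_pos n).ne'
    exact mul_ne_zero hD hn.1
  obtain ⟨_, h⟩ := exists_irrational_of_integerLinearForms (ι := Fin 1) (fun _ => ξ)
    (fun n => (a n : ℝ) + b n * ξ) a (fun n _ => b n) (fun n => by simp) hsmall hne
  exact h

end ApproximationCertificate

/-! ### The two targets of the cell -/

/-- **`ζ(5)`**: an `ApproximationCertificate` for `ζ(5) = zetaValue 5` proves the tree's open
statement `ZetaFiveIrrational`. (Implication only; no certificate is constructed.) -/
theorem zetaFiveIrrational_of_approximationCertificate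
    (cert : ApproximationCertificate (zetaValue 5)) : ZetaFiveIrrational :=
  cert.irrational

/-- **Catalan's constant**: an `ApproximationCertificate` for `catalanConstant` proves the tree's
open statement `CatalanIrrational`. (Implication only; no certificate is constructed.) -/
theorem catalanIrrational_of_approximationCertificate
    (cert : ApproximationCertificate catalanConstant) : CatalanIrrational :=
  cert.irrational

end Summit.KontsevichZagierPeriods.Zeta5Search
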